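import Summits.NavierStokesRegularity.NavierStokesRegularity.Theorems.ExtremiserTransienceNearExtremalTransienceExtremiserLiouvilleConstantSpeedSlideVariationLimit
import HarnessLib

/-!
# Crux `ExtremiserTransience.NearExtremalTransience` (stmt-NavierStokesRegularity-21883), line `extremiser_liouville`,
# stub K1b — THE STRETCHING VARIATION PASSES TO THE LIMIT along the discrete slide (record §13, R1, part 2)

`--supports stmt-NavierStokesRegularity-21883` (helper).  Author: prover seat `ns-el-k1b` (g8).  Sequel of
`…SlideVariationLimit` (enstrophy part): with `ψ_h = −h⁻¹φ̂_h`, `φ_g = g∂₂V + g′V_h`,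
* `tendsto_firstVar_stretching_slideQuotient` : **`J₁(ψ_h) → J₁(−φ_g)` as `h → 0⁺`**
  (`|J₁(ψ₁) − J₁(ψ₂)| ≤ 12B√Z‖Dψ₁ − Dψ₂‖₂` and `h⁻¹Dφ̂_h → Dφ_g` in `L²`).
Together with `slideKKT` (p727196) only the palinstrophy term `c₁(ψ_h)` remains to be bounded (discrete product rule, R2–R4).

WHAT THIS IS NOT: K1b is NOT proved; nothing here proves NS regularity. [folklore]
-/

noncomputable section

open Set Filter Topology MeasureTheory Metric Function InnerProductSpace
open scoped ENNReal NNReal Topology InnerProductSpace RealInnerProductSpace ContDiff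
open Literature.Analysis.FluidPDE Literature.Analysis

namespace Summit.NavierStokesRegularity.NavierStokesRegularity.Theorems

-- the problem directory repeats the summit name (`NavierStokesRegularity/NavierStokesRegularity`)
set_option linter.dupNamespace false

namespace ExtremiserLiouville

open DepletionLadder.KStar

variable {v V : EuclideanSpace ℝ (Fin 3) → EuclideanSpace ℝ (Fin 3)} {g : ℝ → ℝ}

/-- **The stretching variation passes to the limit along the discrete slide**:
`J₁(−h⁻¹φ̂_h) → J₁(−φ_g)` as `h → 0⁺` (`‖Dv‖ ≤ B`, `curl v ∈ L²`; apply with `V = v − c`). [folklore] -/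
theorem tendsto_firstVar_stretching_slideQuotient (hv : ContDiff ℝ 1 v) {B : ℝ} (hB : ∀ x, ‖fderiv ℝ v x‖ ≤ B)
    (hZ : Integrable (fun x => ‖curl v x‖ ^ 2) (volume : Measure (EuclideanSpace ℝ (Fin 3))))
    (hV : ContDiff ℝ ∞ V) (hg : ContDiff ℝ ∞ g) {T K0 K1 K2 K3 : ℝ}
    (hK0 : ∀ s, |g s| ≤ K0) (hK1 : ∀ s, |deriv g s| ≤ K1) (hK2 : ∀ s, |deriv (deriv g) s| ≤ K2)
    (hK3 : ∀ s, |deriv (deriv (deriv g)) s| ≤ K3)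
    (hT1 : ∀ s, T < |s| → deriv g s = 0) (hT2 : ∀ s, T < |s| → deriv (deriv g) s = 0)
    (hT3 : ∀ s, T < |s| → deriv (deriv (deriv g)) s = 0)
    (h1 : ∫⁻ x, ‖iteratedFDeriv ℝ 1 V x‖ₑ ^ 2 < ⊤) (h2 : ∫⁻ x, ‖iteratedFDeriv ℝ 2 V x‖ₑ ^ 2 < ⊤)
    (hslab : Integrable (fun x => {x : EuclideanSpace ℝ (Fin 3) | |x 2| ≤ T}.indicator (fun x => ‖V x‖ ^ 2) x) volume) :
    Tendsto (fun h : ℝ => ∫ x,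
        (⟪curl (fun x : EuclideanSpace ℝ (Fin 3) => (-h⁻¹) • (g (x 2) • V x - g ((x + (-h) • EuclideanSpace.single (2 : Fin 3) (1 : ℝ)) 2) • V (x + (-h) • EuclideanSpace.single (2 : Fin 3) (1 : ℝ)) -
          (∫ t in (-h)..0, deriv g ((x + t • EuclideanSpace.single (2 : Fin 3) (1 : ℝ)) 2) * V (x + t • EuclideanSpace.single (2 : Fin 3) (1 : ℝ)) 2) • EuclideanSpace.single (2 : Fin 3) (1 : ℝ))) x, fderiv ℝ v x (curl v x)⟫ +
          ⟪curl v x, fderiv ℝ (fun x : EuclideanSpace ℝ (Fin 3) => (-h⁻¹) • (g (x 2) • V x - g ((x + (-h) • EuclideanSpace.single (2 : Fin 3) (1 : ℝ)) 2) • V (x + (-h) • EuclideanSpace.single (2 : Fin 3) (1 : ℝ)) -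
          (∫ t in (-h)..0, deriv g ((x + t • EuclideanSpace.single (2 : Fin 3) (1 : ℝ)) 2) * V (x + t • EuclideanSpace.single (2 : Fin 3) (1 : ℝ)) 2) • EuclideanSpace.single (2 : Fin 3) (1 : ℝ))) x (curl v x)⟫ +
          ⟪curl v x, fderiv ℝ v x (curl (fun x : EuclideanSpace ℝ (Fin 3) => (-h⁻¹) • (g (x 2) • V x - g ((x + (-h) • EuclideanSpace.single (2 : Fin 3) (1 : ℝ)) 2) • V (x + (-h) • EuclideanSpace.single (2 : Fin 3) (1 : ℝ)) -
          (∫ t in (-h)..0, deriv g ((x + t • EuclideanSpace.single (2 : Fin 3) (1 : ℝ)) 2) * V (x + t • EuclideanSpace.single (2 : Fin 3) (1 : ℝ)) 2) • EuclideanSpace.single (2 : Fin 3) (1 : ℝ))) x)⟫)) (𝓝[>] 0)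
      (𝓝 (∫ x, (⟪curl (fun y : EuclideanSpace ℝ (Fin 3) => -(g (y 2) • fderiv ℝ V y (EuclideanSpace.single (2 : Fin 3) (1 : ℝ)) + deriv g (y 2) • (V y - (V y 2) • EuclideanSpace.single (2 : Fin 3) (1 : ℝ)))) x, fderiv ℝ v x (curl v x)⟫ +
          ⟪curl v x, fderiv ℝ (fun y : EuclideanSpace ℝ (Fin 3) => -(g (y 2) • fderiv ℝ V y (EuclideanSpace.single (2 : Fin 3) (1 : ℝ)) + deriv g (y 2) • (V y - (V y 2) • EuclideanSpace.single (2 : Fin 3) (1 : ℝ)))) x (curl v x)⟫ +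
          ⟪curl v x, fderiv ℝ v x (curl (fun y : EuclideanSpace ℝ (Fin 3) => -(g (y 2) • fderiv ℝ V y (EuclideanSpace.single (2 : Fin 3) (1 : ℝ)) + deriv g (y 2) • (V y - (V y 2) • EuclideanSpace.single (2 : Fin 3) (1 : ℝ)))) x)⟫))) := by
  set e₂ : EuclideanSpace ℝ (Fin 3) := EuclideanSpace.single (2 : Fin 3) (1 : ℝ) with he₂
  have hproj : ContDiff ℝ ∞ fun y : EuclideanSpace ℝ (Fin 3) => y 2 :=
    (EuclideanSpace.proj (2 : Fin 3) : EuclideanSpace ℝ (Fin 3) →L[ℝ] ℝ).contDiff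
  have hγ : ContDiff ℝ ∞ (deriv g) := (contDiff_infty_iff_deriv.mp hg).2
  have hφgs : ContDiff ℝ ∞ (fun y : EuclideanSpace ℝ (Fin 3) => (g (y 2) • fderiv ℝ V y e₂ + deriv g (y 2) • (V y - (V y 2) • e₂))) :=
    ((hg.comp hproj).smul ((hV.fderiv_right (m := ∞) (by exact_mod_cast le_rfl)).clm_apply contDiff_const)).add
      ((hγ.comp hproj).smul (hV.sub ((hproj.comp hV).smul contDiff_const)))
  have hφgd : Differentiable ℝ (fun y : EuclideanSpace ℝ (Fin 3) => (g (y 2) • fderiv ℝ V y e₂ + deriv g (y 2) • (V y - (V y 2) • e₂))) := hφgs.differentiable (by simp)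
  have hψ0s : ContDiff ℝ 1 fun y : EuclideanSpace ℝ (Fin 3) => -(g (y 2) • fderiv ℝ V y e₂ + deriv g (y 2) • (V y - (V y 2) • e₂)) := (hφgs.of_le (WithTop.coe_le_coe.mpr le_top)).neg
  have hDg : Integrable (fun x => ‖fderiv ℝ (fun y : EuclideanSpace ℝ (Fin 3) => (g (y 2) • fderiv ℝ V y e₂ + deriv g (y 2) • (V y - (V y 2) • e₂))) x‖ ^ 2) (volume : Measure (EuclideanSpace ℝ (Fin 3))) :=
    integrable_sq_norm_fderiv_slideGenerator hV hg hK0 hK1 hK2 hK3 hT1 hT2 hT3 h1 h2 hslab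
  have hDneg : ∀ x, fderiv ℝ (fun y : EuclideanSpace ℝ (Fin 3) => -(g (y 2) • fderiv ℝ V y e₂ + deriv g (y 2) • (V y - (V y 2) • e₂))) x = -fderiv ℝ (fun y : EuclideanSpace ℝ (Fin 3) => (g (y 2) • fderiv ℝ V y e₂ + deriv g (y 2) • (V y - (V y 2) • e₂))) x := fun x => fderiv_fun_neg
  have hD0 : Integrable (fun x => ‖fderiv ℝ (fun y : EuclideanSpace ℝ (Fin 3) => -(g (y 2) • fderiv ℝ V y e₂ + deriv g (y 2) • (V y - (V y 2) • e₂))) x‖ ^ 2)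
      (volume : Measure (EuclideanSpace ℝ (Fin 3))) := by
    refine hDg.congr (Eventually.of_forall fun x => ?_)
    show ‖fderiv ℝ (fun y : EuclideanSpace ℝ (Fin 3) => (g (y 2) • fderiv ℝ V y e₂ + deriv g (y 2) • (V y - (V y 2) • e₂))) x‖ ^ 2 = ‖fderiv ℝ (fun y : EuclideanSpace ℝ (Fin 3) => -(g (y 2) • fderiv ℝ V y e₂ + deriv g (y 2) • (V y - (V y 2) • e₂))) x‖ ^ 2
    rw [hDneg, norm_neg]
  have hφhs : ∀ h : ℝ, ContDiff ℝ ∞ (fun x : EuclideanSpace ℝ (Fin 3) => (g (x 2) • V x - g ((x + (-h) • e₂) 2) • V (x + (-h) • e₂) - (∫ t in (-h)..0, deriv g ((x + t • e₂) 2) * V (x + t • e₂) 2) • e₂)) := fun h => contDiff_slideQuotient hV hg h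
  -- the gradient convergence, in real form
  have hT := tendsto_lintegral_fderiv_slideQuotient_sub hV hg hK0 hK1 hK2 hK3 hT1 hT2 hT3 h1 h2 hslab
  have hTr : Tendsto (fun h : ℝ => (∫⁻ x, ‖h⁻¹ • fderiv ℝ (fun x : EuclideanSpace ℝ (Fin 3) => (g (x 2) • V x - g ((x + (-h) • e₂) 2) • V (x + (-h) • e₂) - (∫ t in (-h)..0, deriv g ((x + t • e₂) 2) * V (x + t • e₂) 2) • e₂)) x - fderiv ℝ (fun y : EuclideanSpace ℝ (Fin 3) => (g (y 2) • fderiv ℝ V y e₂ + deriv g (y 2) • (V y - (V y 2) • e₂))) x‖ₑ ^ 2).toReal) (𝓝[>] 0) (𝓝 0) := by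
    have h0 := (ENNReal.tendsto_toReal ENNReal.zero_ne_top).comp hT
    rw [ENNReal.toReal_zero] at h0
    exact h0
  have hbound : Tendsto (fun h : ℝ => 12 * B * Real.sqrt (∫ x, ‖curl v x‖ ^ 2) *
      Real.sqrt ((∫⁻ x, ‖h⁻¹ • fderiv ℝ (fun x : EuclideanSpace ℝ (Fin 3) => (g (x 2) • V x - g ((x + (-h) • e₂) 2) • V (x + (-h) • e₂) - (∫ t in (-h)..0, deriv g ((x + t • e₂) 2) * V (x + t • e₂) 2) • e₂)) x - fderiv ℝ (fun y : EuclideanSpace ℝ (Fin 3) => (g (y 2) • fderiv ℝ V y e₂ + deriv g (y 2) • (V y - (V y 2) • e₂))) x‖ₑ ^ 2).toReal)) (𝓝[>] 0) (𝓝 0) := by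
    have hs := (Real.continuous_sqrt.tendsto 0).comp hTr
    rw [Real.sqrt_zero] at hs
    have := hs.const_mul (12 * B * Real.sqrt (∫ x, ‖curl v x‖ ^ 2))
    rw [mul_zero] at this
    exact this
  -- squeeze
  rw [← tendsto_sub_nhds_zero_iff]
  refine squeeze_zero_norm' ?_ hbound
  filter_upwards [eventually_mem_nhdsWithin] with h hh
  have hpos : 0 < h := hh
  have hψs : ContDiff ℝ 1 fun x : EuclideanSpace ℝ (Fin 3) => (-h⁻¹) • (g (x 2) • V x - g ((x + (-h) • e₂) 2) • V (x + (-h) • e₂) - (∫ t in (-h)..0, deriv g ((x + t • e₂) 2) * V (x + t • e₂) 2) • e₂) :=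
    ((hφhs h).const_smul (-h⁻¹)).of_le (WithTop.coe_le_coe.mpr le_top)
  have hDh : Integrable (fun x => ‖fderiv ℝ (fun x : EuclideanSpace ℝ (Fin 3) => (-h⁻¹) • (g (x 2) • V x - g ((x + (-h) • e₂) 2) • V (x + (-h) • e₂) - (∫ t in (-h)..0, deriv g ((x + t • e₂) 2) * V (x + t • e₂) 2) • e₂)) x‖ ^ 2)
      (volume : Measure (EuclideanSpace ℝ (Fin 3))) :=
    integrable_sq_norm_fderiv_slideQuotient_smul hV hg hK0 hK1 hK2 hK3 hT1 hT2 hT3 h1 h2 hslab hpos.le (-h⁻¹)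
  have hle := abs_firstVar_stretching_sub_le hv hψs hψ0s hB hZ hDh hD0
  rw [Real.norm_eq_abs]
  refine hle.trans (le_of_eq ?_)
  congr 2
  -- `∫‖Dψ_h − Dψ₀‖² = (∫⁻‖h⁻¹Dφ̂_h − Dφ_g‖ₑ²).toReal`
  have hφhd : Differentiable ℝ (fun x : EuclideanSpace ℝ (Fin 3) => (g (x 2) • V x - g ((x + (-h) • e₂) 2) • V (x + (-h) • e₂) - (∫ t in (-h)..0, deriv g ((x + t • e₂) 2) * V (x + t • e₂) 2) • e₂)) := (hφhs h).differentiable (by simp)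
  have hDs : ∀ x, fderiv ℝ (fun x : EuclideanSpace ℝ (Fin 3) => (-h⁻¹) • (g (x 2) • V x - g ((x + (-h) • e₂) 2) • V (x + (-h) • e₂) - (∫ t in (-h)..0, deriv g ((x + t • e₂) 2) * V (x + t • e₂) 2) • e₂)) x = (-h⁻¹) • fderiv ℝ (fun x : EuclideanSpace ℝ (Fin 3) => (g (x 2) • V x - g ((x + (-h) • e₂) 2) • V (x + (-h) • e₂) - (∫ t in (-h)..0, deriv g ((x + t • e₂) 2) * V (x + t • e₂) 2) • e₂)) x := fun x =>
    ((hφhd x).hasFDerivAt.const_smul (-h⁻¹)).fderiv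
  have hpt : ∀ x, fderiv ℝ (fun x : EuclideanSpace ℝ (Fin 3) => (-h⁻¹) • (g (x 2) • V x - g ((x + (-h) • e₂) 2) • V (x + (-h) • e₂) - (∫ t in (-h)..0, deriv g ((x + t • e₂) 2) * V (x + t • e₂) 2) • e₂)) x -
      fderiv ℝ (fun y : EuclideanSpace ℝ (Fin 3) => -(g (y 2) • fderiv ℝ V y e₂ + deriv g (y 2) • (V y - (V y 2) • e₂))) x =
      -(h⁻¹ • fderiv ℝ (fun x : EuclideanSpace ℝ (Fin 3) => (g (x 2) • V x - g ((x + (-h) • e₂) 2) • V (x + (-h) • e₂) - (∫ t in (-h)..0, deriv g ((x + t • e₂) 2) * V (x + t • e₂) 2) • e₂)) x - fderiv ℝ (fun y : EuclideanSpace ℝ (Fin 3) => (g (y 2) • fderiv ℝ V y e₂ + deriv g (y 2) • (V y - (V y 2) • e₂))) x) := by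
    intro x
    rw [hDs, hDneg]
    module
  have c1 : Continuous fun x => fderiv ℝ (fun x : EuclideanSpace ℝ (Fin 3) => (g (x 2) • V x - g ((x + (-h) • e₂) 2) • V (x + (-h) • e₂) - (∫ t in (-h)..0, deriv g ((x + t • e₂) 2) * V (x + t • e₂) 2) • e₂)) x := (hφhs h).continuous_fderiv (by simp)
  have c2 : Continuous fun x => h⁻¹ • fderiv ℝ (fun x : EuclideanSpace ℝ (Fin 3) => (g (x 2) • V x - g ((x + (-h) • e₂) 2) • V (x + (-h) • e₂) - (∫ t in (-h)..0, deriv g ((x + t • e₂) 2) * V (x + t • e₂) 2) • e₂)) x := c1.const_smul h⁻¹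
  have c3 : Continuous fun x => fderiv ℝ (fun y : EuclideanSpace ℝ (Fin 3) => (g (y 2) • fderiv ℝ V y e₂ + deriv g (y 2) • (V y - (V y 2) • e₂))) x := hφgs.continuous_fderiv (by simp)
  have hmeas : AEStronglyMeasurable (fun x => h⁻¹ • fderiv ℝ (fun x : EuclideanSpace ℝ (Fin 3) => (g (x 2) • V x - g ((x + (-h) • e₂) 2) • V (x + (-h) • e₂) - (∫ t in (-h)..0, deriv g ((x + t • e₂) 2) * V (x + t • e₂) 2) • e₂)) x - fderiv ℝ (fun y : EuclideanSpace ℝ (Fin 3) => (g (y 2) • fderiv ℝ V y e₂ + deriv g (y 2) • (V y - (V y 2) • e₂))) x)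
      (volume : Measure (EuclideanSpace ℝ (Fin 3))) := (c2.sub c3).aestronglyMeasurable
  refine Eq.trans (integral_congr_ae (Eventually.of_forall fun x => ?_)) (integral_sq_norm_eq_toReal_lintegral hmeas)
  change ‖_‖ ^ 2 = ‖_‖ ^ 2
  rw [hpt, norm_neg]

end ExtremiserLiouville

end Summit.NavierStokesRegularity.NavierStokesRegularity.Theorems

end
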